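import Summits.CriticalPhenomena.SAWScalingLimit.Theses.SAWDefectDecoherence

/-!
# Skeleton line `dressed-arrival-cauchy-transform` for crux `BoundaryClosureR` (stmt-CriticalPhenomena-14004)

Route `SAWDefectDecoherence`, crux r4
`BoundaryClosureR := DefectDecoherence → MassRatio → HexObservableLimitR` — the boundary
Riemann–Hilbert half of Duminil-Copin–Smirnov's Conjecture 2 GIVEN the route's two exponent
cruxes, over the REPAIRED target `HexObservableLimitR` (root `a` and normaliser `b` both pinned
conformally: flat horizontal half-plane piece + exact half-lattice `{v | m i δ ≤ v.1 1}` inside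
`ball (pt i) ρ`).

## The line (idea `dressed-arrival-cauchy-transform`, ideator 2 gen 2; triage r1: 3 × pass)

LEVER.  The exact discrete Cauchy–Pompeiu identity (any `g : ℂ → ℂ`; interior edges cancel,
`g(c_v)·(vertex relation) = 0`)
`Σ_{e ∈ ∂Ω_δ} (mid e − c_v) g(mid e) F_δ(e) = Σ_{v ∈ Λ_δ} Σ_{t ∼ v} (mid − c_v)(g(mid) − g(c_v)) F_δ(vt)`
is pushed to the lattice boundary.  Per vertex the right side is
`(±iℓδ/2)∂g·T(v) + (ℓδ/2)²∂̄g·S(v) + O(δ³|∇²g| M_v)` with `T(v) = Σ_t conj(mid − c_v)F(vt)` the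
route's vertex-star curl defect (`DefectDecoherence`), `S(v) = Σ_t F(vt)` the signal and
`M_v = Σ_t Z(vt)` the star mass.  With `g = G_ψ :=` (Cauchy transform of a bulk test function
`ψ`, `∂̄ = πψ`) minus its 1-jet at the discrete root, the `∂̄`-part IS the target functional:
`δ²⟨ψ, F_δ⟩/F_δ(b_δ) = (6/π)·⟨ν_δ, G_ψ⟩ + Rem_δ(ψ)`, where
`ν_δ := (δ/F_δ(b_δ)) Σ_{e ∈ ∂Ω_δ} (mid e − c_v) F_δ(e) δ_{δ·mid e}` is the PHASE-DRESSED BOUNDARY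
ARRIVAL MEASURE (each atom = positive arrival mass `Z_δ(e)` × exact lattice phase, by winding
rigidity) and the remainder is the `∂G_ψ`-pairing of `T` over the WHOLE domain plus Taylor junk.
AT THE ROUTE'S CUT the remainder is `o(1)`: bulk `O(η^{−θ} δ^{θ−3/4})` by `DefectDecoherence` +
`MassRatio`; collar and root ball `δ·Σ_{r ≤ η/δ} r^{κ−θ} = O(δ^{min(1,θ−κ)})` from a positive-mass
layer profile with `κ < θ` (predicted `κ = 25/48`, so `θ > 3/4` has the route's margin `11/48`) —
the step re-derived and certified by all three triagers (it corrects the pool's "θ > 73/48").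
CONSEQUENCES (stubs 1, 4): holomorphic boundary SUM RULES `⟨ν_δ, (z − a')² h⟩ → 0` for entire `h`
(asymptotic Cauchy theorem up to `∂Ω`), the CAUCHY REPRESENTATION of the bulk functional, and —
with positive-mass TIGHTNESS of `(z − a')ν_δ` and the local `L¹` bound — subsequential limits that
are holomorphic for free and of TRACE CLASS: `f(w) = (6/π)(w − a)^{−2} ∫_{∂Ω} dν̃(z)/(z − w)` with
`ν̃` a finite ANALYTIC measure on `∂Ω` (`∫ zⁿ dν̃ = 0`, `n ≥ 0`), hence (F. and M. Riesz, pulled back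
to `𝕋`; Smirnov class `E¹` for rectifiable carriers) absolutely continuous, with a.e. boundary
values of `f` equal to the dressed arrival density — the Riemann–Hilbert datum handed to the limit
with NO continuity hypothesis.  CLOSING (stubs 5–7): one root does not identify `f` (the half-CR
barrier's kernel returns as boundary-modulus freedom on rough arcs), so the closing is the TWO-ROOT
quotient in the Smirnov/Nevanlinna setting: exact two-valued phase of `F^x/F^{x'}` on every
boundary edge (arc constancy, exact), proportionality near rough arcs (`RatioContinuity`),
regularity at the roots (`RootRegularity`: zero-free, exact order `5/4`, non-zero flat boundary
values — LOWER bounds the Cauchy engine does not deliver), flat anchors (`FlatTrace`,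
`FlatLocality`) and reciprocity `Z_x(y_δ) = Z_y(x_δ)` ⇒ `‖f_a‖ = |K||Φ'/Φ'(b)|^{5/8}` with constant
phase on the flat piece `I ∋ b` ⇒ Schwarz reflection + identity theorem ⇒
`f_a = c·exp((5/8)(L − L_b))` (`Identification`).  `closing` (sorry-free, this file) turns
`TraceLimits + RootRegularity + Identification` into `HexObservableLimitR` by the subsequence
principle on `𝓝[>] 0`; `BoundaryClosureR_of` is the kernel-checked composition concluding the crux
BY NAME.

RELATION TO `Lines/two-root-quotient` (planned under the retired id 8536, 7 stubs registered on
this item): this line REPLACES the compactness half of its `stub_cupLimits` by stubs 1–4 (Φ-free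
positive-mass inputs + the local `L¹` bound + classical compactness) and KEEPS its regularity half
as the explicit stub 5; stub 6 is the conjunction of its three leaf stubs `RatioContinuity`,
`FlatTrace`, `FlatLocality` VERBATIM (same vocabulary `AdmissibleFamily` / `PinnedFlatRoot` /
`IsCupLimit` / `IsWeakLimit`, so one proof serves both lines); stub 7 merges its
`stub_rootRatioLaw` + `stub_closingArgument`, now run with genuine a.e. boundary values (trace
class) instead of continuity up to `∂Ω`.

## Disproof / negatives used (`Cruxes/BoundaryClosureR/Disproof.lean`, cdisprove cycle 1, re-read at start)
* (F0) `not_crux_iff`: every stub is a PROOF device for `HexObservableLimitR` given DD, MR; no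
  `_false_without_` exists on the crux side (F3) — DD, MR enter stub 1 (bulk pairing at the cut)
  and stub 5 (root regularity) as the devices they are.
* (F2) `target_false_without_rootPin` — honoured at STUB 1: the representation divides by
  `F_δ(b_δ)` while the root atom is `F(a) = 1`; the 1-jet subtraction at the DISCRETE root and the
  `|z − a'|`-weighted collar budget need the flat pinned root (`Z_δ(b_δ) ≍ δ^{5/4}` polynomially);
  in the corridor-at-the-root family the sum rules are false (dressed mass concentrates at the
  corridor tip).  `target_false_without_normaliserPin` — honoured at STUB 6 (`FlatTrace` (i)/(ii):
  the boundary-layer constant `K` and the arrival ratios along `I` live in the exact half-lattice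
  ball at `b`; a dead-end corridor ending at `b_δ` rescales `F(b_δ)` alone).
* (F4) the redundant `Nonempty` clause is kept in `AdmissiblePinnedFamily` (verbatim frame of the
  target, so `closing` is a projection).  (F5) consistent with the stub audit of two-root-quotient
  (sign of the root-ratio law, `FlatTrace` disjointness clause, Umlaufsatz for arc constancy).
  (F6a) everything at `b` is inside the fixed-`ρ` rigid ball; (F6b) armchair pieces change only
  the UNDRESSED constant — the frame pins `b` on the one-class zigzag row.
* Landed negatives `Theorems/BoundaryClosureR/Negative/{RootPin,NormaliserPin,EndCorridor,PeelEnd,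
  ShiftedHalfDisc}` and `SAWDefectDecoherenceHexObservableLimit_refuted` (corridor family): no stub
  is an instance — every statement pins BOTH marked points (`AdmissiblePinnedFamily` /
  `PinnedFlatRoot`) and concludes the repaired target.  `ledger negatives` (9 entries: 5420, 8312,
  0772, 8261, percolation/Cardy items): no all-δ quantifier (everything eventual along `𝓝[>] 0`),
  constants only per connected `Ω` and per pinned point, nothing restated.
-/

noncomputable section

open scoped BigOperators ComplexConjugate Topology Classical
open Filter Set MeasureTheory
open Literature.Probability.LatticeModels Literature.Probability.RandomPlanarGeometry
open Literature.Probability.RandomPlanarGeometry.SAW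
open Summit.CriticalPhenomena.SAWScalingLimit.Theses.SAWDefectDecoherence

namespace Summit.CriticalPhenomena.SAWScalingLimit.Cruxes.BoundaryClosureR.DressedArrivalCauchyTransform

/-! ### 1. Vocabulary

`NF`, `arrivalMass`, `IsTest`, `AdmissibleFamily`, `PinnedFlatRoot`, `IsWeakLimit`, `flatPoints`,
`IsCupLimit` are VERBATIM the vocabulary of `Lines/two-root-quotient` (so that stub 6 is literally
the conjunction of three stubs registered there); `AdmissiblePinnedFamily` is the frame of
`HexObservableLimitR` bundled (both marked points pinned); the rest is this line's. -/

/-- The normalised functional `N^{e}_δ(ψ) := δ² Σ_{z ∈ Ω_δ} ψ(δ·mid z) F^{e δ}(z) / F^{e δ}(b δ)`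
(root family `e`, normalisation family `b`, spin `5/8`, fugacity `x_c`). -/
def NF (Λ : ℝ → Finset HexVertex) (e b : ℝ → Sym2 HexVertex) (δ : ℝ) (ψ : ℂ → ℂ) : ℂ :=
  (δ : ℂ) ^ 2 * (∑ᶠ z ∈ hexDomainMidEdges (Λ δ),
      ψ ((δ : ℂ) * hexMidpoint z) * hexParafermionicObservable (Λ δ) (e δ) hexCriticalFugacity (5 / 8) z) /
    hexParafermionicObservable (Λ δ) (e δ) hexCriticalFugacity (5 / 8) (b δ)

/-- The arrival mass `Z^{e δ}(z) = F_{x_c, 0}(z) ≥ 0` (the spin-`0` observable is a nonnegative real;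
we take its norm). -/
def arrivalMass (Λ : ℝ → Finset HexVertex) (e : ℝ → Sym2 HexVertex) (δ : ℝ) (z : Sym2 HexVertex) : ℝ :=
  ‖hexParafermionicObservable (Λ δ) (e δ) hexCriticalFugacity 0 z‖

/-- Bulk test functions of the target: continuous, compactly supported inside the domain. -/
def IsTest (D : DobrushinDomain) (ψ : ℂ → ℂ) : Prop :=
  Continuous ψ ∧ HasCompactSupport ψ ∧ tsupport ψ ⊆ D.carrier

/-- The frame of the repaired target `HexObservableLimitR` (stmt-14003), bundled VERBATIM: flat
horizontal half-plane pieces in the `ρ`-balls about BOTH marked points, an eventually admissible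
family (simply connected, both marked mid-edges on the boundary, walks `a → b` exist, connected,
inside `Ω`, exact half-lattice `{row ≥ m i δ}` in both balls), exhausting compacts, with
`δ·mid(a δ) → pt 0` and `δ·mid(b δ) → pt 1`. -/
def AdmissiblePinnedFamily (D : DobrushinDomain) (ρ : ℝ) (Λ : ℝ → Finset HexVertex)
    (m : Fin 2 → ℝ → ℤ) (a b : ℝ → Sym2 HexVertex) : Prop :=
  0 < ρ ∧
  (∀ i : Fin 2, D.carrier ∩ Metric.ball (D.pt i) ρ =
      {z : ℂ | (D.pt i).im < z.im} ∩ Metric.ball (D.pt i) ρ) ∧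
  (∀ᶠ δ : ℝ in 𝓝[>] 0, hexDomainSimplyConnected (Λ δ) ∧ a δ ∈ hexDomainBoundary (Λ δ) ∧
      b δ ∈ hexDomainBoundary (Λ δ) ∧ Nonempty (HexMidEdgeSAW (Λ δ) (a δ) (b δ)) ∧
      (hexGraph.induce ((Λ δ : Finset HexVertex) : Set HexVertex)).Preconnected ∧
      (∀ v ∈ Λ δ, (δ : ℂ) * hexCenter v ∈ D.carrier) ∧
      (∀ i : Fin 2, ∀ v : HexVertex, (δ : ℂ) * hexCenter v ∈ Metric.ball (D.pt i) ρ →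
        (v ∈ Λ δ ↔ m i δ ≤ v.1 1))) ∧
  (∀ K : Set ℂ, IsCompact K → K ⊆ D.carrier →
      ∀ᶠ δ : ℝ in 𝓝[>] 0, ∀ v : HexVertex, (δ : ℂ) * hexCenter v ∈ K → v ∈ Λ δ) ∧
  Tendsto (fun δ : ℝ => (δ : ℂ) * hexMidpoint (a δ)) (𝓝[>] 0) (𝓝 (D.pt 0)) ∧
  Tendsto (fun δ : ℝ => (δ : ℂ) * hexMidpoint (b δ)) (𝓝[>] 0) (𝓝 (D.pt 1))

/-- The root-free part of the target's hypotheses (verbatim `two-root-quotient`): flat piece and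
exact half-lattice around the normalisation point `D.pt 1`, eventual admissibility of `Λ δ`,
exhaustion of compacts, `b δ → pt 1`. -/
def AdmissibleFamily (D : DobrushinDomain) (ρ : ℝ) (Λ : ℝ → Finset HexVertex) (m : ℝ → ℤ)
    (b : ℝ → Sym2 HexVertex) : Prop :=
  0 < ρ ∧
  D.carrier ∩ Metric.ball (D.pt 1) ρ = {z : ℂ | (D.pt 1).im < z.im} ∩ Metric.ball (D.pt 1) ρ ∧
  (∀ᶠ δ : ℝ in 𝓝[>] 0, hexDomainSimplyConnected (Λ δ) ∧ b δ ∈ hexDomainBoundary (Λ δ) ∧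
      (hexGraph.induce ((Λ δ : Finset HexVertex) : Set HexVertex)).Preconnected ∧
      (∀ v ∈ Λ δ, (δ : ℂ) * hexCenter v ∈ D.carrier) ∧
      (∀ v : HexVertex, (δ : ℂ) * hexCenter v ∈ Metric.ball (D.pt 1) ρ → (v ∈ Λ δ ↔ m δ ≤ v.1 1))) ∧
  (∀ K : Set ℂ, IsCompact K → K ⊆ D.carrier →
      ∀ᶠ δ : ℝ in 𝓝[>] 0, ∀ v : HexVertex, (δ : ℂ) * hexCenter v ∈ K → v ∈ Λ δ) ∧
  Tendsto (fun δ : ℝ => (δ : ℂ) * hexMidpoint (b δ)) (𝓝[>] 0) (𝓝 (D.pt 1))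

/-- A root family `e` PINNED on a flat piece at `x ∈ ∂D` (verbatim `two-root-quotient`): inside
`ball x r` the domain is the open half-plane above `x` and `Λ δ` is exactly the half-lattice
`{v | mr δ ≤ v.1 1}`; the roots are boundary mid-edges with `δ·mid(e δ) → x`, and walks to the
normaliser exist. -/
def PinnedFlatRoot (D : DobrushinDomain) (Λ : ℝ → Finset HexVertex) (b : ℝ → Sym2 HexVertex)
    (x : ℂ) (e : ℝ → Sym2 HexVertex) (r : ℝ) (mr : ℝ → ℤ) : Prop :=
  0 < r ∧
  D.carrier ∩ Metric.ball x r = {z : ℂ | x.im < z.im} ∩ Metric.ball x r ∧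
  (∀ᶠ δ : ℝ in 𝓝[>] 0, e δ ∈ hexDomainBoundary (Λ δ) ∧ Nonempty (HexMidEdgeSAW (Λ δ) (e δ) (b δ)) ∧
      (∀ v : HexVertex, (δ : ℂ) * hexCenter v ∈ Metric.ball x r → (v ∈ Λ δ ↔ mr δ ≤ v.1 1))) ∧
  Tendsto (fun δ : ℝ => (δ : ℂ) * hexMidpoint (e δ)) (𝓝[>] 0) (𝓝 x)

/-- `g` is the weak limit of the normalised functionals of root family `e` along the mesh sequence
`ns` (verbatim `two-root-quotient`): `N^{e}_{ns n}(ψ) → ∫ ψ g` for every bulk test function. -/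
def IsWeakLimit (D : DobrushinDomain) (Λ : ℝ → Finset HexVertex) (e b : ℝ → Sym2 HexVertex)
    (ns : ℕ → ℝ) (g : ℂ → ℂ) : Prop :=
  ∀ ψ : ℂ → ℂ, IsTest D ψ → Tendsto (fun n => NF Λ e b (ns n) ψ) atTop (𝓝 (∫ z, ψ z * g z))

/-- The flat boundary points seen by a root pinned at `x` (radius `r`) (verbatim
`two-root-quotient`): the normaliser's flat piece `I` and the root's own flat piece. -/
def flatPoints (D : DobrushinDomain) (ρ : ℝ) (x : ℂ) (r : ℝ) : Set ℂ :=
  ({z : ℂ | z.im = (D.pt 1).im} ∩ Metric.ball (D.pt 1) ρ) ∪ ({z : ℂ | z.im = x.im} ∩ Metric.ball x r)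

/-- Root regularity of a limit density `g` of a root pinned at `x` (verbatim `two-root-quotient`'s
`IsCupLimit`): holomorphic and zero-free on the domain, blow-up of exact order `5/4` at its own
root, and non-zero boundary values at every other flat boundary point. -/
def IsCupLimit (D : DobrushinDomain) (ρ : ℝ) (x : ℂ) (r : ℝ) (g : ℂ → ℂ) : Prop :=
  DifferentiableOn ℂ g D.carrier ∧ (∀ z ∈ D.carrier, g z ≠ 0) ∧
  (∃ κ : ℂ, κ ≠ 0 ∧ Tendsto (fun z => g z * (z - x) ^ ((5 : ℂ) / 4)) (𝓝[D.carrier] x) (𝓝 κ)) ∧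
  (∀ y ∈ flatPoints D ρ x r, y ≠ x → ∃ w : ℂ, w ≠ 0 ∧ Tendsto g (𝓝[D.carrier] y) (𝓝 w))

/-- The PHASE-DRESSED BOUNDARY FUNCTIONAL `⟨ν_δ, G⟩ := (δ / F_δ(b_δ)) Σ_{v ∈ Λ_δ} Σ_{t ∼ v, t ∉ Λ_δ}
G(δ·mid{v,t}) (mid{v,t} − c_v) F_δ({v,t})` — by boundary winding rigidity each term is a POSITIVE
arrival mass `Z_δ(e)` times the exact lattice phase `(ℓ/2) e^{iθ_a} e^{i(3/8)W_e}` times `G(δ e)`. -/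
def dressedBoundaryFunctional (Λ : Finset HexVertex) (a b : Sym2 HexVertex) (δ : ℝ)
    (G : ℂ → ℂ) : ℂ :=
  ((δ : ℂ) / hexParafermionicObservable Λ a hexCriticalFugacity (5 / 8) b) *
    ∑ v ∈ Λ, ∑ᶠ t ∈ {t : HexVertex | hexGraph.Adj v t ∧ t ∉ Λ},
      G ((δ : ℂ) * hexMidpoint s(v, t)) * (hexMidpoint s(v, t) - hexCenter v) *
        hexParafermionicObservable Λ a hexCriticalFugacity (5 / 8) s(v, t)

/-- The lattice depth of a vertex: the distance from `c_v` to the nearest centre of a vertex NOT in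
`Λ` (so `v` is `R`-deep in the sense of `DefectDecoherence` for every `R < hexDepth Λ v`). -/
def hexDepth (Λ : Finset HexVertex) (v : HexVertex) : ℝ :=
  sInf ((fun y : HexVertex => dist (hexCenter y) (hexCenter v)) '' ((↑Λ : Set HexVertex)ᶜ))

/-- The star mass `M_v := Σ_{t ∼ v} Z_δ({v,t})` of a vertex (all three neighbours, boundary edges
included). -/
def starMass (Λ : ℝ → Finset HexVertex) (e : ℝ → Sym2 HexVertex) (δ : ℝ) (v : HexVertex) : ℝ :=
  ∑ᶠ t ∈ {t : HexVertex | hexGraph.Adj v t}, arrivalMass Λ e δ s(v, t)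

/-- Trace-class representation of a limit density of the root pinned at `x`: there is a finite
(complex: `φ·μ`, `‖φ‖ ≤ 1`) measure `ν̃` carried by `∂Ω` which is ANALYTIC (`∫ zⁿ dν̃ = 0` for all
`n ≥ 0` — the limit of the holomorphic sum rules) and whose Cauchy transform represents `f`:
`f(w) = (6/π) (w − x)^{−2} ∫ dν̃(z)/(z − w)` on `Ω`.  (By F. and M. Riesz, pulled back to `𝕋` by the
boundary homeomorphism of a Riemann map, such a `ν̃` is absolutely continuous with an `H¹`
density; for rectifiable `∂Ω`, `(z − x)² f ∈ E¹(Ω)` with a.e. boundary values `12i·dν̃/dz` — used in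
stub 7, not recorded here.) -/
def IsTraceLimit (D : DobrushinDomain) (x : ℂ) (f : ℂ → ℂ) : Prop :=
  ∃ (μ : Measure ℂ) (φ : ℂ → ℂ), IsFiniteMeasure μ ∧ μ (frontier D.carrier)ᶜ = 0 ∧
    Measurable φ ∧ (∀ z, ‖φ z‖ ≤ 1) ∧ (∀ n : ℕ, ∫ z, z ^ n * φ z ∂μ = 0) ∧
    ∀ w ∈ D.carrier, f w = (6 / Real.pi : ℂ) * ((w - x) ^ 2)⁻¹ * ∫ z, φ z / (z - w) ∂μ

/-! ### 2. The statements of the line -/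

/-- POSITIVE-MASS INPUT (i) — the collar pairing budget, in the SUMMED form the remainder
bookkeeping consumes: for every `θ > 3/4` the depth-discounted, `|z − a'|`-weighted star masses of
the `η`-collar are `≤ ε·Z_δ(b_δ)/δ²` eventually, for `η` small.  (Implied by the card's layer profile
`δ²Σ_{depth r}|δc_v − δa_δ|M_v ≤ Cδ Z(b) r^κ`, `κ < θ`: the sum is `δΣ_{r ≤ η/δ} r^{κ−θ} =
O(η^{1+κ−θ} δ^{θ−κ} + δ)`; predicted `κ = 25/48`.  Unlike an `O(1)` bound on the `r = 0` layer it is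
plausible for ALL admissible families, cascading mesoscopic collars included: it only asks the
collar contribution to be `o(Z(b)/δ²)`.) -/
def CollarPairingBudget : Prop :=
  ∀ (D : DobrushinDomain) (ρ : ℝ) (Λ : ℝ → Finset HexVertex) (m : Fin 2 → ℝ → ℤ)
    (a b : ℝ → Sym2 HexVertex), AdmissiblePinnedFamily D ρ Λ m a b →
    ∀ θ : ℝ, 3 / 4 < θ → ∀ ε : ℝ, 0 < ε → ∃ η : ℝ, 0 < η ∧ ∀ᶠ δ : ℝ in 𝓝[>] 0,
      δ ^ 2 * ∑ v ∈ (Λ δ).filter (fun v => Metric.infDist ((δ : ℂ) * hexCenter v) D.carrierᶜ ≤ η),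
          min 1 (hexDepth (Λ δ) v ^ (-θ)) * ‖(δ : ℂ) * hexCenter v - (δ : ℂ) * hexMidpoint (a δ)‖ *
            starMass Λ a δ v ≤
        ε * arrivalMass Λ a δ (b δ)

/-- POSITIVE-MASS INPUT (ii) — total mass bound: `δ³ Σ_{z ∈ Ω_δ} Z_δ(z) = o(Z_δ(b_δ))` (controls the
second-order Taylor junk `O(δ³ Σ |∇²G| M)` of the representation everywhere; predicted `δ^{23/48}`). -/
def TotalMassBound : Prop :=
  ∀ (D : DobrushinDomain) (ρ : ℝ) (Λ : ℝ → Finset HexVertex) (m : Fin 2 → ℝ → ℤ)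
    (a b : ℝ → Sym2 HexVertex), AdmissiblePinnedFamily D ρ Λ m a b →
    Tendsto (fun δ : ℝ => δ ^ 3 * (∑ᶠ z ∈ hexDomainMidEdges (Λ δ), arrivalMass Λ a δ z) /
        arrivalMass Λ a δ (b δ)) (𝓝[>] 0) (𝓝 0)

/-- POSITIVE-MASS INPUT (iii) — boundary arrival tightness (THE BET of the line): the
`|z − a'|`-weighted total boundary arrival mass is `O(Z_δ(b_δ)/δ)`, i.e. the dressed measures
`(z − a')ν_δ` have bounded total variation.  Dimensionally consistent at the root
(`δ²Σ_k k·k^{−5/4}/δ^{5/4} ≍ η^{3/4}`) and far from it (`(L/δ)·δ·O(1)`); expected to FAIL when the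
collar cascades over many mesoscopic scales or the carrier is a multifractal quasicircle
(`∫_{∂Ω}|Φ'|^{5/8}|dz| = ∞`, triage r1-1 (iii)) — it is used ONLY by stub 4 (the trace). -/
def BoundaryArrivalTightness : Prop :=
  ∀ (D : DobrushinDomain) (ρ : ℝ) (Λ : ℝ → Finset HexVertex) (m : Fin 2 → ℝ → ℤ)
    (a b : ℝ → Sym2 HexVertex), AdmissiblePinnedFamily D ρ Λ m a b →
    ∃ C : ℝ, ∀ᶠ δ : ℝ in 𝓝[>] 0,
      δ * ∑ v ∈ Λ δ, ∑ᶠ t ∈ {t : HexVertex | hexGraph.Adj v t ∧ t ∉ Λ δ},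
          ‖(δ : ℂ) * hexMidpoint s(v, t) - (δ : ℂ) * hexMidpoint (a δ)‖ * arrivalMass Λ a δ s(v, t) ≤
        C * arrivalMass Λ a δ (b δ)

/-- The positive-mass package of the line (stub 2): collar pairing budget, total mass bound,
boundary arrival tightness — all three are UPPER bounds on positive, domain-monotone arrival masses
in the pinned frame, Φ-free and decidable size by size (exact enumeration / transfer matrices). -/
def ArrivalMassBudget : Prop :=
  CollarPairingBudget ∧ TotalMassBound ∧ BoundaryArrivalTightness

/-- The local `L¹` bound (stub 3; VERBATIM the `LocalL1Bound` of `Lines/pick-half-plane`, so the two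
lines register the same stub): for every admissible family and every pinned flat root `x ≠ pt 1`, on
every compact `K ⊂ Ω`, `δ² Σ_{z : δ·mid z ∈ K} |F_δ(z)| ≤ C_K |F_δ(b_δ)|` eventually.  NECESSARY for the
target by Banach–Steinhaus (convergence against every `ψ ∈ C_c(K)` forces eventual boundedness on
`C(K)`); its curl part `δ²Σ_K |T|` is free from `DefectDecoherence` + `MassRatio`, the un-mollified
signal part `δ²Σ_K |S|` is the "exponent-sharp Harnack" content (the `U`-channel is identically
zero: it is the vertex relation, triage r1-3).  The frame-root instance used by stub 4 is
`m := m 1`, `x := pt 0`, `e := a`, `r := ρ`, `mr := m 0` (`pt 0 ≠ pt 1` by `pt_injective`). -/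
def LocalL1Bound : Prop :=
  ∀ (D : DobrushinDomain) (ρ : ℝ) (Λ : ℝ → Finset HexVertex) (m : ℝ → ℤ) (b : ℝ → Sym2 HexVertex),
    AdmissibleFamily D ρ Λ m b →
  ∀ (x : ℂ) (e : ℝ → Sym2 HexVertex) (r : ℝ) (mr : ℝ → ℤ), PinnedFlatRoot D Λ b x e r mr → x ≠ D.pt 1 →
  ∀ K : Set ℂ, IsCompact K → K ⊆ D.carrier → ∃ C : ℝ, ∀ᶠ δ : ℝ in 𝓝[>] 0,
    δ ^ 2 * (∑ᶠ z ∈ {z : Sym2 HexVertex | z ∈ hexDomainMidEdges (Λ δ) ∧ (δ : ℂ) * hexMidpoint z ∈ K},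
        ‖hexParafermionicObservable (Λ δ) (e δ) hexCriticalFugacity (5 / 8) z‖) ≤
      C * ‖hexParafermionicObservable (Λ δ) (e δ) hexCriticalFugacity (5 / 8) (b δ)‖

/-- OUTPUT OF STUB 1 — the boundary sum rules of the line, for every admissible pinned family:
(o) normaliser modulus `|F_δ(b_δ)| = Z_δ(b_δ)` eventually (boundary winding rigidity at the pinned
normaliser: one class, one winding); (i) HOLOMORPHIC SUM RULE: for every entire `h` the dressed
boundary functional of `(z − δ·mid a_δ)² h` tends to `0` (asymptotic Cauchy theorem up to `∂Ω`,
second-order zero at the DISCRETE root); (ii) CAUCHY REPRESENTATION: for `ψ ∈ C²_c(Ω)` with Cauchy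
transform `g(ζ) = ∫ ψ(w)/(ζ − w) dA(w)` (`∂̄g = πψ`) and `a' := δ·mid(a δ)`,
`N_δ(ψ) − (6/π)·⟨ν_δ, g − g(a') − g'(a')(· − a')⟩ → 0` (`6/π = 2/(πℓ²)`, `ℓ² = 1/3`). -/
def BoundarySumRules : Prop :=
  ∀ (D : DobrushinDomain) (ρ : ℝ) (Λ : ℝ → Finset HexVertex) (m : Fin 2 → ℝ → ℤ)
    (a b : ℝ → Sym2 HexVertex), AdmissiblePinnedFamily D ρ Λ m a b →
    (∀ᶠ δ : ℝ in 𝓝[>] 0,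
        ‖hexParafermionicObservable (Λ δ) (a δ) hexCriticalFugacity (5 / 8) (b δ)‖ =
          arrivalMass Λ a δ (b δ)) ∧
    (∀ h : ℂ → ℂ, Differentiable ℂ h →
        Tendsto (fun δ : ℝ => dressedBoundaryFunctional (Λ δ) (a δ) (b δ) δ
            (fun z => (z - (δ : ℂ) * hexMidpoint (a δ)) ^ 2 * h z)) (𝓝[>] 0) (𝓝 0)) ∧
    (∀ ψ : ℂ → ℂ, ContDiff ℝ 2 ψ → HasCompactSupport ψ → tsupport ψ ⊆ D.carrier →
        let g : ℂ → ℂ := fun ζ => ∫ w, ψ w / (ζ - w)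
        Tendsto (fun δ : ℝ => NF Λ a b δ ψ -
            (6 / Real.pi : ℂ) * dressedBoundaryFunctional (Λ δ) (a δ) (b δ) δ
              (fun ζ => g ζ - g ((δ : ℂ) * hexMidpoint (a δ)) -
                deriv g ((δ : ℂ) * hexMidpoint (a δ)) * (ζ - (δ : ℂ) * hexMidpoint (a δ))))
          (𝓝[>] 0) (𝓝 0))

/-- OUTPUT OF STUB 4 — trace-class subsequential limits: for every admissible pinned family, every
mesh sequence has a subsequence along which the normalised functionals converge weakly (against
ALL continuous bulk test functions) to a density that is holomorphic on `Ω` and of trace class at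
the root `pt 0`. -/
def TraceLimits : Prop :=
  ∀ (D : DobrushinDomain) (ρ : ℝ) (Λ : ℝ → Finset HexVertex) (m : Fin 2 → ℝ → ℤ)
    (a b : ℝ → Sym2 HexVertex), AdmissiblePinnedFamily D ρ Λ m a b →
    ∀ ns : ℕ → ℝ, Tendsto ns atTop (𝓝[>] 0) →
      ∃ ms : ℕ → ℕ, StrictMono ms ∧ ∃ f : ℂ → ℂ, DifferentiableOn ℂ f D.carrier ∧
        IsTraceLimit D (D.pt 0) f ∧ IsWeakLimit D Λ a b (ns ∘ ms) f

/-- OUTPUT OF STUB 5 — root regularity: every holomorphic weak limit (against all continuous bulk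
test functions, along any mesh sequence) of an admissible pinned family is a cup limit at `pt 0`:
zero-free on `Ω`, blow-up of exact order `5/4` with non-zero constant at the root, non-zero boundary
values at the other points of the two flat pieces.  (The regularity half of two-root-quotient's
`stub_cupLimits`; LOWER bounds — not delivered by the Cauchy-transform engine.) -/
def RootRegularity : Prop :=
  ∀ (D : DobrushinDomain) (ρ : ℝ) (Λ : ℝ → Finset HexVertex) (m : Fin 2 → ℝ → ℤ)
    (a b : ℝ → Sym2 HexVertex), AdmissiblePinnedFamily D ρ Λ m a b →
    ∀ ns : ℕ → ℝ, Tendsto ns atTop (𝓝[>] 0) →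
      ∀ f : ℂ → ℂ, DifferentiableOn ℂ f D.carrier → IsWeakLimit D Λ a b ns f →
        IsCupLimit D ρ (D.pt 0) ρ f

/-- Two-root boundary Harnack principle (verbatim `two-root-quotient`'s `RatioContinuity`,
registered there as `stub_ratioContinuity`): near every boundary point `p` other than the two pinned
flat roots, on every locally connected piece `S` of `Λ δ` inside the ball, the observables from the
two roots are asymptotically PROPORTIONAL as functions of the target mid-edge (division-free
determinant form; the Kennedy–Lawler class factor of a boundary target cancels because the target is
the same for both roots; local connectivity excludes the far-attached dead-end corridor). -/
def RatioContinuity : Prop :=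
  ∀ (D : DobrushinDomain) (ρ : ℝ) (Λ : ℝ → Finset HexVertex) (m : ℝ → ℤ) (b : ℝ → Sym2 HexVertex),
    AdmissibleFamily D ρ Λ m b →
  ∀ (x : ℂ) (e : ℝ → Sym2 HexVertex) (r : ℝ) (mr : ℝ → ℤ)
    (x' : ℂ) (e' : ℝ → Sym2 HexVertex) (r' : ℝ) (mr' : ℝ → ℤ),
    PinnedFlatRoot D Λ b x e r mr → PinnedFlatRoot D Λ b x' e' r' mr' → x ≠ x' →
  ∀ p ∈ frontier D.carrier, p ≠ x → p ≠ x' →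
  ∀ ε : ℝ, 0 < ε → ∃ s : ℝ, 0 < s ∧ ∀ᶠ δ : ℝ in 𝓝[>] 0,
    ∀ S : Finset HexVertex, S ⊆ Λ δ → (∀ v ∈ S, (δ : ℂ) * hexCenter v ∈ Metric.ball p s) →
      (hexGraph.induce ((S : Finset HexVertex) : Set HexVertex)).Preconnected →
    ∀ z ∈ hexDomainMidEdges (Λ δ), ∀ z' ∈ hexDomainMidEdges (Λ δ),
      (∃ v ∈ z, v ∈ S) → (∃ v ∈ z', v ∈ S) →
      ‖hexParafermionicObservable (Λ δ) (e δ) hexCriticalFugacity (5 / 8) z *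
            hexParafermionicObservable (Λ δ) (e' δ) hexCriticalFugacity (5 / 8) z' -
          hexParafermionicObservable (Λ δ) (e δ) hexCriticalFugacity (5 / 8) z' *
            hexParafermionicObservable (Λ δ) (e' δ) hexCriticalFugacity (5 / 8) z‖ ≤
        ε * (‖hexParafermionicObservable (Λ δ) (e δ) hexCriticalFugacity (5 / 8) z‖ *
              ‖hexParafermionicObservable (Λ δ) (e' δ) hexCriticalFugacity (5 / 8) z'‖ +
            ‖hexParafermionicObservable (Λ δ) (e δ) hexCriticalFugacity (5 / 8) z'‖ *
              ‖hexParafermionicObservable (Λ δ) (e' δ) hexCriticalFugacity (5 / 8) z‖)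

/-- Flat-root locality (verbatim `two-root-quotient`'s `FlatLocality`, registered there as
`stub_flatLocality`): two pinned flat roots see the same exact half-lattice, so along a common mesh
sequence their blow-up constants agree up to the normalisations, `‖κ‖ = μ ‖κ'‖` with
`μ = lim Z_{x'}(b_δ)/Z_x(b_δ)`. -/
def FlatLocality : Prop :=
  ∀ (D : DobrushinDomain) (ρ : ℝ) (Λ : ℝ → Finset HexVertex) (m : ℝ → ℤ) (b : ℝ → Sym2 HexVertex),
    AdmissibleFamily D ρ Λ m b →
  ∀ (x : ℂ) (e : ℝ → Sym2 HexVertex) (r : ℝ) (mr : ℝ → ℤ)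
    (x' : ℂ) (e' : ℝ → Sym2 HexVertex) (r' : ℝ) (mr' : ℝ → ℤ),
    PinnedFlatRoot D Λ b x e r mr → PinnedFlatRoot D Λ b x' e' r' mr' → x ≠ D.pt 1 → x' ≠ D.pt 1 →
  ∀ ns : ℕ → ℝ, Tendsto ns atTop (𝓝[>] 0) →
  ∀ (g g' : ℂ → ℂ) (κ κ' : ℂ) (μ : ℝ),
    IsWeakLimit D Λ e b ns g → IsWeakLimit D Λ e' b ns g' →
    Tendsto (fun z => g z * (z - x) ^ ((5 : ℂ) / 4)) (𝓝[D.carrier] x) (𝓝 κ) →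
    Tendsto (fun z => g' z * (z - x') ^ ((5 : ℂ) / 4)) (𝓝[D.carrier] x') (𝓝 κ') →
    Tendsto (fun n => arrivalMass Λ e' (ns n) (b (ns n)) / arrivalMass Λ e (ns n) (b (ns n)))
      atTop (𝓝 μ) →
    ‖κ‖ = μ * ‖κ'‖

/-- Flat trace with ONE universal boundary-layer constant `K ≠ 0` (verbatim `two-root-quotient`'s
`FlatTrace`, registered there as `stub_flatTrace`): for a cup limit `g` of a pinned flat root
`x ≠ pt 1`, (i) its boundary value at the normalisation point is `K`; (ii) at every point `y ≠ x` of
the flat piece `I` around `pt 1`, approached by boundary mid-edges `ey δ`, the arrival-mass ratios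
`Z_x(ey_δ)/Z_x(b_δ)` converge to `‖w‖/‖K‖`, `w` the boundary value of `g` at `y`; (iii) if the root's
ball misses the normaliser's, the phase of `w` is that of `K`.  (This is where the NORMALISER PIN is
consumed: Disproof `target_false_without_normaliserPin`.) -/
def FlatTrace : Prop :=
  ∃ K : ℂ, K ≠ 0 ∧
  ∀ (D : DobrushinDomain) (ρ : ℝ) (Λ : ℝ → Finset HexVertex) (m : ℝ → ℤ) (b : ℝ → Sym2 HexVertex),
    AdmissibleFamily D ρ Λ m b →
  ∀ (x : ℂ) (e : ℝ → Sym2 HexVertex) (r : ℝ) (mr : ℝ → ℤ), PinnedFlatRoot D Λ b x e r mr → x ≠ D.pt 1 →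
  ∀ ns : ℕ → ℝ, Tendsto ns atTop (𝓝[>] 0) →
  ∀ g : ℂ → ℂ, IsCupLimit D ρ x r g → IsWeakLimit D Λ e b ns g →
    Tendsto g (𝓝[D.carrier] (D.pt 1)) (𝓝 K) ∧
    ∀ (y : ℂ) (ey : ℝ → Sym2 HexVertex) (w : ℂ),
      y.im = (D.pt 1).im → y ∈ Metric.ball (D.pt 1) ρ → y ≠ x →
      (∀ᶠ δ : ℝ in 𝓝[>] 0, ey δ ∈ hexDomainBoundary (Λ δ)) →
      Tendsto (fun δ : ℝ => (δ : ℂ) * hexMidpoint (ey δ)) (𝓝[>] 0) (𝓝 y) →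
      Tendsto g (𝓝[D.carrier] y) (𝓝 w) →
      Tendsto (fun n => arrivalMass Λ e (ns n) (ey (ns n)) / arrivalMass Λ e (ns n) (b (ns n)))
          atTop (𝓝 (‖w‖ / ‖K‖)) ∧
        (Disjoint (Metric.ball x r) (Metric.ball (D.pt 1) ρ) → w = K * ((‖w‖ / ‖K‖ : ℝ) : ℂ))

/-- The boundary-locality package of the closing (stub 6): the conjunction of the three leaf
statements of `two-root-quotient` — the two-root boundary Harnack principle, the flat trace with a
universal constant, flat-root locality (engine for the first two: `birkhoff-crosscut-contraction`;
the third is decoherence-type). -/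
def BoundaryRatioLaws : Prop :=
  RatioContinuity ∧ FlatTrace ∧ FlatLocality

/-- OUTPUT OF STUB 7 — identification of every regular trace-class subsequential limit of the
TARGET's root with ONE universal constant: `f = c · exp((5/8)(L − L_b))` on the domain. -/
def Identification : Prop :=
  ∃ c : ℂ, c ≠ 0 ∧
  ∀ (D : DobrushinDomain) (ρ : ℝ) (Λ : ℝ → Finset HexVertex) (m : Fin 2 → ℝ → ℤ)
    (a b : ℝ → Sym2 HexVertex), AdmissiblePinnedFamily D ρ Λ m a b →
  ∀ (Φ : ConformalEquiv D.carrier UpperHalfPlane.upperHalfPlaneSet) (L : ℂ → ℂ) (Lb : ℂ),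
    Tendsto (fun z => ‖Φ z‖) (𝓝[D.carrier] (D.pt 0)) atTop → Φ.HasBoundaryValue (D.pt 1) 0 →
    ContinuousOn L D.carrier → (∀ z ∈ D.carrier, Complex.exp (L z) = deriv Φ z) →
    Tendsto L (𝓝[D.carrier] (D.pt 1)) (𝓝 Lb) →
  ∀ ns : ℕ → ℝ, Tendsto ns atTop (𝓝[>] 0) →
  ∀ f : ℂ → ℂ, IsTraceLimit D (D.pt 0) f → IsCupLimit D ρ (D.pt 0) ρ f → IsWeakLimit D Λ a b ns f →
    ∀ z ∈ D.carrier, f z = c * Complex.exp ((5 / 8 : ℂ) * (L z - Lb))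

/-! ### 3. The registered stubs (the only `sorry`s of the file) -/

/-- STUB 1 (L; the card's item 1 — the lever): the Cauchy representation and the holomorphic sum
rules AT THE ROUTE'S CUT.  Proof plan: the exact discrete Cauchy–Pompeiu identity
(`Ideator2gSketch.DiscreteCauchyPompeiu`, from `DuminilCopinSmirnov2012_lemma1_holds`; prove it as
a `--supports` helper), boundary winding rigidity at `b` (item 8515) for conjunct (o), the
per-vertex expansion `(±iℓδ/2)∂G·T + (ℓδ/2)²∂̄G·S + O(δ³|∇²G|M)`, `∂̄g_ψ = πψ`, and the remainder
bookkeeping: bulk `T`-pairing by `DefectDecoherence` (vertices with `infDist > η` are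
`(η/2δ)`-deep by exhaustion) and `MassRatio`; collar and root ball by `CollarPairingBudget` (with
`|∂G(z)| ≤ C|z − a'|`, `G` vanishing to second order at the discrete root); Taylor junk by
`TotalMassBound`. -/
theorem stub_cauchyRepresentation :
    DefectDecoherence → MassRatio → CollarPairingBudget → TotalMassBound → BoundarySumRules := by
  sorry

/-- STUB 2 (L; open, Φ-free, positive-mass): the arrival-mass budget of the pinned frame —
collar pairing budget, total mass bound, boundary arrival tightness. -/
theorem stub_arrivalMassBudget : ArrivalMassBudget := by
  sorry

/-- STUB 3 (L–XL; open): the local `L¹` bound of the normalised observable on compacts. -/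
theorem stub_localL1Bound : LocalL1Bound := by
  sorry

/-- STUB 4 (L; classical analysis): compactness and the trace.  From `LocalL1Bound` (+ the
normaliser modulus) the bulk functionals are eventually bounded on each `C(K)`, so a diagonal
subsequence converges against all of `C_c(Ω)` (Banach–Alaoglu); from `BoundaryArrivalTightness` the
dressed measures `ν̃_δ = (z − a')²ν_δ` have bounded variation in a fixed compact, so a further
subsequence converges weak-* to `ν̃ = φ·μ`, carried by `∂Ω` (boundary mid-edges accumulate only on
`∂Ω`, by exhaustion and boundedness of `Ω`), ANALYTIC by the sum rule, and the Cauchy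
representation passes to the limit (`G_{ψ,δ}/(z − a')² → G_ψ/(z − pt 0)²` uniformly off `supp ψ`)
and un-folds by Fubini to `∫ ψ f`, `f(w) = (6/π)(w − pt 0)^{−2}∫ dν̃/(z − w)` holomorphic; density
of `C²_c` in `C_c(K)` + the `L¹` bound extend `∫ ψ f` to all test functions. -/
theorem stub_traceCompactness :
    BoundaryArrivalTightness → LocalL1Bound → BoundarySumRules → TraceLimits := by
  sorry

/-- STUB 5 (XL; open — HARDEST): root regularity of the holomorphic weak limits (zero-free, exact
order `5/4` at the pinned root, non-zero flat boundary values).  Suppliers: the cup engine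
(degree-one cup from the exact `3/8` phase law, univalence in measure from `DefectDecoherence` +
`MassRatio` at the cut, Hurwitz, apex angle `π/4`), or Pick positivity on convex carriers
(`pick-half-plane`); the trace representation (available through `TraceLimits` + uniqueness of weak
limits) gives the boundary measure to argue with. -/
theorem stub_rootRegularity : DefectDecoherence → MassRatio → TraceLimits → RootRegularity := by
  sorry

/-- STUB 6 (L; open): the boundary-locality package `RatioContinuity ∧ FlatTrace ∧ FlatLocality`
(three leaf stubs of `two-root-quotient`, verbatim). -/
theorem stub_boundaryRatioLaws : BoundaryRatioLaws := by
  sorry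

/-- STUB 7 (L; classical analysis given stubs 4–6): the Smirnov-class closing.  For auxiliary
roots `y` pinned on the flat piece `I` (re-mark `D` at `(y, pt 1)` to get their trace limits and
regularity from `TraceLimits`/`RootRegularity`): two-root arc constancy (exact Umlaufsatz lemma,
`two-root-quotient`'s `stub_twoRootArcConstancy`, proved as a helper) + `RatioContinuity` give the
quotient `E := f_y (1 − Φ/t_y)^{5/4} / f_a` constant argument a.e. and two-sided bounds near
`∂Ω ∖ {a, y}`; root regularity bounds it at `a` and `y`; a bounded holomorphic function with real
a.e. boundary values (F. and M. Riesz / Poisson representation of `H¹`, Mashreghi Thm 5.10, 7.13) is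
constant ⇒ root-ratio law `f_y = (1 − Φ/t_y)^{−5/4} f_a` (`= 1` at `b` by `FlatTrace` (i)); then
covariance of blow-ups + `FlatLocality` + exact RECIPROCITY `Z_x(y_δ) = Z_y(x_δ)` + `FlatTrace`
(ii)/(iii) ⇒ `‖f_a‖ = |K| |Φ'/Φ'(b)|^{5/8}` with constant phase on `I` ⇒ Schwarz reflection across
the straight arc + identity theorem ⇒ `f_a = K exp((5/8)(L − L_b))`, `c := K`. -/
theorem stub_smirnovClosing :
    TraceLimits → RootRegularity → BoundaryRatioLaws → Identification := by
  sorry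

/-! ### Name-keyed aliases of the seven stub statements (hypotheses of the composition)

`Registered.stub_X` is the statement of `stub_X` under the registered stub's short name, so that the
native skeleton audit (`#h21_check_skeleton`: hypotheses admissible iff registered obligations /
declared stubs BY NAME) accepts `BoundaryClosureR_of : Registered.stub_… → … → BoundaryClosureR`
(same device as `Lines/two-root-quotient`). -/
namespace Registered

/-- Alias keyed by the registered stub name. -/
abbrev stub_cauchyRepresentation : Prop :=
  DefectDecoherence → MassRatio → CollarPairingBudget → TotalMassBound → BoundarySumRules
/-- Alias keyed by the registered stub name. -/
abbrev stub_arrivalMassBudget : Prop := ArrivalMassBudget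
/-- Alias keyed by the registered stub name. -/
abbrev stub_localL1Bound : Prop := LocalL1Bound
/-- Alias keyed by the registered stub name. -/
abbrev stub_traceCompactness : Prop :=
  BoundaryArrivalTightness → LocalL1Bound → BoundarySumRules → TraceLimits
/-- Alias keyed by the registered stub name. -/
abbrev stub_rootRegularity : Prop := DefectDecoherence → MassRatio → TraceLimits → RootRegularity
/-- Alias keyed by the registered stub name. -/
abbrev stub_boundaryRatioLaws : Prop := BoundaryRatioLaws
/-- Alias keyed by the registered stub name. -/
abbrev stub_smirnovClosing : Prop := TraceLimits → RootRegularity → BoundaryRatioLaws → Identification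

end Registered

/-! ### 4. The sorry-free part: subsequence principle and the composition -/

/-- **Closing step (no `sorry`)**: trace-class limits along subsequences of every mesh sequence
(`TraceLimits`), their regularity (`RootRegularity`) and their identification with one universal
constant (`Identification`) give the pinned target, by `Filter.tendsto_of_subseq_tendsto` on the
countably generated filter `𝓝[>] 0`. -/
theorem closing (hT : TraceLimits) (hR : RootRegularity) (hI : Identification) :
    HexObservableLimitR := by
  obtain ⟨c, hc, hId⟩ := hI
  refine ⟨c, hc, ?_⟩
  intro D ρ Λ m a b Φ L Lb ψ F hρ hflat hadm hexh ha hb hΦ hΦb hL hexpL hLb hψc hψK hψD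
  -- repackage the hypotheses of the target as the bundled frame
  have hAPF : AdmissiblePinnedFamily D ρ Λ m a b := ⟨hρ, hflat, hadm, hexh, ha, hb⟩
  have hψ : IsTest D ψ := ⟨hψc, hψK, hψD⟩
  -- the subsequence principle on the countably generated filter `𝓝[>] 0`
  refine Filter.tendsto_of_subseq_tendsto fun ns hns => ?_
  obtain ⟨ms, hms, f, hf, htr, hw⟩ := hT D ρ Λ m a b hAPF ns hns
  have hns' : Tendsto (ns ∘ ms) atTop (𝓝[>] 0) := hns.comp hms.tendsto_atTop
  have hcup : IsCupLimit D ρ (D.pt 0) ρ f := hR D ρ Λ m a b hAPF (ns ∘ ms) hns' f hf hw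
  have hid : ∀ z ∈ D.carrier, f z = c * Complex.exp ((5 / 8 : ℂ) * (L z - Lb)) :=
    hId D ρ Λ m a b hAPF Φ L Lb hΦ hΦb hL hexpL hLb (ns ∘ ms) hns' f htr hcup hw
  -- the limit density is `c · exp((5/8)(L - Lb))` on the domain and `ψ` vanishes off the domain
  have hint : ∫ z, ψ z * f z = c * ∫ z, ψ z * Complex.exp ((5 / 8 : ℂ) * (L z - Lb)) := by
    rw [← integral_const_mul]
    refine integral_congr_ae (Filter.Eventually.of_forall fun z => ?_)
    by_cases hz : z ∈ D.carrier
    · simp only [hid z hz]; ring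
    · have hψz : ψ z = 0 := image_eq_zero_of_notMem_tsupport fun h => hz (hψD h)
      simp only [hψz, zero_mul, mul_zero]
  have key := hw ψ hψ
  rw [hint] at key
  exact ⟨ms, key⟩

/-- **The composition (kernel-checked, no `sorry`)**: the seven stubs imply the crux
`BoundaryClosureR` BY NAME.  Given the antecedents `DefectDecoherence`, `MassRatio`: STUB 1 (fed by
the collar and total-mass conjuncts of STUB 2) gives the boundary sum rules; STUB 4 (fed by the
tightness conjunct of STUB 2, STUB 3 and the sum rules) gives trace-class limits; STUB 5 their
regularity; STUB 7 (fed by STUBS 4, 5, 6) identifies them; `closing` concludes. -/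
theorem BoundaryClosureR_of (h1 : Registered.stub_cauchyRepresentation)
    (h2 : Registered.stub_arrivalMassBudget) (h3 : Registered.stub_localL1Bound)
    (h4 : Registered.stub_traceCompactness) (h5 : Registered.stub_rootRegularity)
    (h6 : Registered.stub_boundaryRatioLaws) (h7 : Registered.stub_smirnovClosing) :
    Summit.CriticalPhenomena.SAWScalingLimit.Theses.SAWDefectDecoherence.BoundaryClosureR :=
  fun hDD hMR =>
    have hS : BoundarySumRules := h1 hDD hMR h2.1 h2.2.1
    have hT : TraceLimits := h4 h2.2.2 h3 hS
    have hR : RootRegularity := h5 hDD hMR hT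
    closing hT hR (h7 hT hR h6)

/-- Wiring check: the registered stubs feed `BoundaryClosureR_of` as stated. -/
example : Summit.CriticalPhenomena.SAWScalingLimit.Theses.SAWDefectDecoherence.BoundaryClosureR :=
  BoundaryClosureR_of stub_cauchyRepresentation stub_arrivalMassBudget stub_localL1Bound
    stub_traceCompactness stub_rootRegularity stub_boundaryRatioLaws stub_smirnovClosing

end Summit.CriticalPhenomena.SAWScalingLimit.Cruxes.BoundaryClosureR.DressedArrivalCauchyTransform

end
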